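import Summits.Ventures.Crystal3D.Theorems.StickyWulffConstantTextureBuildContactEngine
import Summits.Ventures.Crystal3D.Theorems.StickyWulffConstantTextureBuildContactClasses
import Summits.Ventures.Crystal3D.Theorems.StickyWulffConstantTextureBuildLawWeights
import Summits.Ventures.Crystal3D.Theorems.StickyWulffConstantTextureBuildCutInput
import Summits.Ventures.Crystal3D.Theorems.StickyWulffConstantTextureBuildCoplanarFacets
import Summits.Ventures.Crystal3D.Theorems.StickyWulffConstantPolycrystalWulffBoundFacetAreaSymm
import HarnessLib

/-!
# TB-energy blueprint, the CUT SPECIALS, part 1: cell frames carry the class lattices; cut-table domination; the cut-plane area bound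
# (lane T, crux `TextureLiminfV5`, stmt-Ventures-23912; TB-D-3-g20 §stub_LS (CUTS) + addendum «LS_cut: the frame identification»)

HONEST FRAMING. Venture `Summits/Ventures/Crystal3D` (cell `crystal3d-full`), route `route-Ventures-StickyWulffConstant`, helper `--supports` the
law-v5 crux `TextureLiminfV5` (stmt-Ventures-23912).  Bookkeeping over the labelled cells of a texture input (standard axioms; no mesh constructed; F-C1 not moved).

WHAT (for the cut half (L-C) of `stub_LS`):
* `sharedAxis_comm`, `coAx_comm`; `image_rigid_bilayer` — with the aligned presentations of `Mesh₄.hpres₁/₂` the placed model bilayers ARE the tents' bilayers;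
* **`Mesh₅.cell_lattice₁/₂`** — the placed bilayer frames `(A₁ a)·M`, `(A₂ b)·M` of wall cell `k` carry the lattices of the class frames
  `(tent (fk k)).frame a`, `(tent (gk k)).frame b` (whole-bilayer rigidity `image_fccRef_eq_of_bilayer_subset`);
* **`lawW_le_cell_of_below_above` / `…_of_above_below`** — across the cut plane (`±M e₃`) the texture's weight between a piece below the cut (class
  `(fk k, a)`) and a piece above it (class `(gk k, b)`) is at most `c_k(a,b)/2` (…LawWeights `lawC_mul_supportFn_le_cell` + `Mesh₃.hlaw`);
* `cutDatum_mem_Hp_or`, `not_cutDatum_mem_Hp_both`, `below_of_cutDatum_mem`, `above_of_antip_cutDatum_mem` — which side a piece of the prism is on;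
* `cut_term_le`, `cut_term_le'` — one ledger term across the cut is `≤ c/2 · area` against a piece on the other side and `0` against the same side;
* **`sum_sum_facetArea_cut_le`** — Σ_{i below, slab a} Σ_{i' above, slab b} area(cl i ∩ cut plane ∩ cl i') ≤ area(cl P_k ∩ cl slab_a ∩ cl slab_b ∩ cut plane)
  (…CoplanarFacets `sum_facetArea_inter_le_of_sameSide`, twice) — the region of `Good.hcut` / `Mesh₄.exists_good_cut`.
-/

noncomputable section

open scoped BigOperators InnerProductSpace ENNReal
open MeasureTheory Set

namespace Summit.Ventures.Crystal3D.Cruxes.TextureLiminf.TexShadow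

open Summit.Ventures.Crystal3D Summit.Ventures.Crystal3D.Theorems
open Summit.Ventures.Crystal3D.TentCertificate (image_fccRef_eq_of_bilayer_subset)

/-! ### Symmetry of the frame predicates -/

/-- A shared axis is shared both ways. -/
theorem sharedAxis_comm {m : E3} {A B : E3 ≃ₗᵢ[ℝ] E3} (h : SharedAxis m A B) : SharedAxis m B A := by
  obtain ⟨L, s₁, s₂, σ, σ', hσ, hσ', hLe, hA, hB⟩ := h
  exact ⟨L, s₂, s₁, σ', σ, hσ', hσ, hLe, hB, hA⟩

/-- Co-axiality is symmetric. -/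
theorem coAx_comm {A B : E3 ≃ₗᵢ[ℝ] E3} (h : CoAx A B) : CoAx B A := by
  obtain ⟨m, hm⟩ := h
  exact ⟨m, sharedAxis_comm hm⟩

/-! ### Placed bilayers -/

/-- **Aligned presentations have the same bilayers**: if the placed model presentation `(L₁, s₁)` is the presentation `(L, s)`, the placed model
bilayers are the bilayers. -/
theorem image_rigid_bilayer (M : E3 ≃ₗᵢ[ℝ] E3) (t : E3) {L₁ L : E3 ≃ₗᵢ[ℝ] E3} {s₁ s : E3}
    (hpres : ∀ r : E3, rigid M t (L₁ r + s₁) = L r + s) (σ : ℤ → ℤ) (i : ℤ) :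
    rigid M t '' bilayer L₁ s₁ σ i = bilayer L s σ i := by
  ext y
  constructor
  · rintro ⟨z, ⟨r, hr, rfl⟩, rfl⟩
    exact ⟨r, hr, (hpres r).symm⟩
  · rintro ⟨r, hr, rfl⟩
    exact ⟨L₁ r + s₁, ⟨r, hr, rfl⟩, hpres r⟩

/-- A constraint of an `H`-polytope bounds it. -/
theorem polytope_subset_halfspace {H : Finset (E3 × ℝ)} {p : E3 × ℝ} (hp : p ∈ H) : polytope H ⊆ {x : E3 | ⟪p.1, x⟫_ℝ < p.2} := by
  intro x hx
  simp only [polytope, mem_iInter] at hx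
  exact hx p hp

namespace Mesh₅

variable {C R₀ : ℝ} {N : ℕ} {x : Fin N → E3} {rc : RiseredCover C R₀ N x} {δ : ℝ} (μ : Mesh₅ rc δ)

/-- **The placed plate-1 bilayer frames of cell `k` carry the lattices of the class frames of grain `fk k`.** -/
theorem cell_lattice₁ (k : Fin rc.nk) (a : ℤ) :
    (((rc.cell k).A₁ a).trans (rc.cell k).M) '' fccRef = ((rc.tent (μ.fk k)).frame a) '' fccRef := by
  obtain ⟨u, hu⟩ := (rc.cell k).hA₁ a
  obtain ⟨u', hu'⟩ := (rc.tent (μ.fk k)).frame_spec a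
  have hσ : (rc.cell k).σ₁ = (rc.tent (μ.fk k)).σ := (μ.hpres₁ k).2
  refine image_fccRef_eq_of_bilayer_subset (rc.tent (μ.fk k)).hσ (rc.tent (μ.fk k)).L (rc.tent (μ.fk k)).s a
    (u := (rc.cell k).M u + (rc.cell k).t) (fun y hy => ?_) hu'
  rw [← hσ, ← image_rigid_bilayer (rc.cell k).M (rc.cell k).t (μ.hpres₁ k).1 (rc.cell k).σ₁ a] at hy
  obtain ⟨z, hz, rfl⟩ := hy
  obtain ⟨q, hq, rfl⟩ := hu hz
  refine ⟨q, hq, ?_⟩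
  simp only [rigid, LinearIsometryEquiv.coe_trans, Function.comp_apply, map_add]
  rw [add_assoc]

/-- **The placed plate-2 bilayer frames of cell `k` carry the lattices of the class frames of grain `gk k`.** -/
theorem cell_lattice₂ (k : Fin rc.nk) (b : ℤ) :
    (((rc.cell k).A₂ b).trans (rc.cell k).M) '' fccRef = ((rc.tent (μ.gk k)).frame b) '' fccRef := by
  obtain ⟨u, hu⟩ := (rc.cell k).hA₂ b
  obtain ⟨u', hu'⟩ := (rc.tent (μ.gk k)).frame_spec b
  have hσ : (rc.cell k).σ₂ = (rc.tent (μ.gk k)).σ := (μ.hpres₂ k).2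
  refine image_fccRef_eq_of_bilayer_subset (rc.tent (μ.gk k)).hσ (rc.tent (μ.gk k)).L (rc.tent (μ.gk k)).s b
    (u := (rc.cell k).M u + (rc.cell k).t) (fun y hy => ?_) hu'
  rw [← hσ, ← image_rigid_bilayer (rc.cell k).M (rc.cell k).t (μ.hpres₂ k).1 (rc.cell k).σ₂ b] at hy
  obtain ⟨z, hz, rfl⟩ := hy
  obtain ⟨q, hq, rfl⟩ := hu hz
  refine ⟨q, hq, ?_⟩
  simp only [rigid, LinearIsometryEquiv.coe_trans, Function.comp_apply, map_add]
  rw [add_assoc]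

end Mesh₅

namespace TexInput

variable {C R₀ : ℝ} {N : ℕ} {x : Fin N → E3} {rc : RiseredCover C R₀ N x} {δ : ℝ} {μ : Mesh₅ rc δ} (I : TexInput rc μ)

/-! ### Which side of the cut -/

/-- Every piece carries the cut datum of cell `k` or its antipode among its signed constraints. -/
theorem cutDatum_mem_Hp_or (i : Fin I.cells.M) (k : Fin rc.nk) :
    I.cutDatum k ∈ I.cells.Hp i ∨ antip (I.cutDatum k) ∈ I.cells.Hp i := by
  by_cases h : I.cutDatum k ∈ I.cells.T (I.cells.idx i)
  · exact Or.inl (mem_signedH_iff.2 ⟨I.cutDatum k, I.cutDatum_mem_𝓗 k, Or.inl ⟨h, rfl⟩⟩)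
  · exact Or.inr (mem_signedH_iff.2 ⟨I.cutDatum k, I.cutDatum_mem_𝓗 k, Or.inr ⟨h, rfl⟩⟩)

/-- A piece with the cut datum among its constraints lies below the cut. -/
theorem below_of_cutDatum_mem {i : Fin I.cells.M} {k : Fin rc.nk} (h : I.cutDatum k ∈ I.cells.Hp i) :
    polytope (I.cells.Hp i) ⊆ {x : E3 | ⟪(I.cutDatum k).1, x⟫_ℝ < (I.cutDatum k).2} :=
  polytope_subset_halfspace h

/-- A piece with the antipodal cut datum among its constraints lies above the cut. -/
theorem above_of_antip_cutDatum_mem {i : Fin I.cells.M} {k : Fin rc.nk} (h : antip (I.cutDatum k) ∈ I.cells.Hp i) :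
    polytope (I.cells.Hp i) ⊆ {x : E3 | ⟪-(I.cutDatum k).1, x⟫_ℝ < -(I.cutDatum k).2} :=
  polytope_subset_halfspace h

/-- Not both. -/
theorem not_cutDatum_mem_Hp_both {i : Fin I.cells.M} {k : Fin rc.nk} (h : I.cutDatum k ∈ I.cells.Hp i)
    (h' : antip (I.cutDatum k) ∈ I.cells.Hp i) : False := by
  obtain ⟨z, hz⟩ := I.cells.hne (I.cells.idx i)
  have h1 := I.below_of_cutDatum_mem h hz
  have h2 := I.above_of_antip_cutDatum_mem h' hz
  simp only [mem_setOf_eq, inner_neg_left] at h1 h2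
  linarith

/-- Below the cut: the cut datum is in the positive part. -/
theorem cutDatum_mem_T_of_mem_Hp {i : Fin I.cells.M} {k : Fin rc.nk} (h : I.cutDatum k ∈ I.cells.Hp i) :
    I.cutDatum k ∈ I.cells.T (I.cells.idx i) := by
  obtain ⟨z, hz⟩ := I.cells.hne (I.cells.idx i)
  exact I.cutDatum_mem_T_of_height_lt hz ((I.height_lt_iff k z).2 (I.below_of_cutDatum_mem h hz))

/-- Above the cut: the cut datum is not in the positive part. -/
theorem cutDatum_not_mem_T_of_antip_mem_Hp {i : Fin I.cells.M} {k : Fin rc.nk} (h : antip (I.cutDatum k) ∈ I.cells.Hp i) :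
    I.cutDatum k ∉ I.cells.T (I.cells.idx i) := by
  obtain ⟨z, hz⟩ := I.cells.hne (I.cells.idx i)
  refine I.cutDatum_not_mem_T_of_lt_height hz ?_
  have h2 := I.above_of_antip_cutDatum_mem h hz
  simp only [mem_setOf_eq, inner_neg_left, neg_lt_neg_iff, cutDatum] at h2
  rw [CellCover.height_eq_inner_frame]
  linarith

/-! ### Cut-table domination -/

/-- **Across the cut plane, below | above: the texture's weight is at most half the cell's table entry.** -/
theorem lawW_le_cell_of_below_above (k : Fin rc.nk) {i i' : Fin I.cells.M} (hi : polytope (I.cells.Hp i) ⊆ polytope (μ.HP k))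
    (hi' : polytope (I.cells.Hp i') ⊆ polytope (μ.HP k)) (hb : I.cutDatum k ∈ I.cells.T (I.cells.idx i))
    (ha : I.cutDatum k ∉ I.cells.T (I.cells.idx i')) {ν : E3} (hν : ν = (rc.cell k).M e₃ ∨ ν = -((rc.cell k).M e₃)) :
    lawW I.frameOf (I.cells.cls i) (I.cells.cls i') ν ≤ (rc.cell k).c (I.slab i) (I.slab i') / 2 := by
  have hgi : I.grain i = μ.fk k := by rw [I.grain_eq_of_piece_subset_HP hi, if_pos hb]
  have hgi' : I.grain i' = μ.gk k := by rw [I.grain_eq_of_piece_subset_HP hi', if_neg ha]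
  have h₁ : (((rc.cell k).A₁ (I.slab i)).trans (rc.cell k).M) '' fccRef = I.frameOf (I.cells.cls i) '' fccRef := by
    rw [I.frameOf_cls i, hgi]; exact μ.cell_lattice₁ k (I.slab i)
  have h₂ : (((rc.cell k).A₂ (I.slab i')).trans (rc.cell k).M) '' fccRef = I.frameOf (I.cells.cls i') '' fccRef := by
    rw [I.frameOf_cls i', hgi']; exact μ.cell_lattice₂ k (I.slab i')
  have hadm := (rc.cell k).hadm
  have hlaw := μ.hlaw k (I.slab i) (I.slab i')
  have h := lawC_mul_supportFn_le_cell I.frameOf (ℓ := I.cells.cls i) (ℓ' := I.cells.cls i') h₁ h₂ (hadm.1 _ _) hlaw.1 hlaw.2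
    (fun hco hne => (hadm.2.2.1 _ _ hco hne).1) hν
  unfold lawW
  have hre : lawC I.frameOf (I.cells.cls i) (I.cells.cls i') / 2 * supportFn (wallBody (lawM I.frameOf (I.cells.cls i) (I.cells.cls i'))) ν =
      lawC I.frameOf (I.cells.cls i) (I.cells.cls i') * supportFn (wallBody (lawM I.frameOf (I.cells.cls i) (I.cells.cls i'))) ν / 2 := by
    ring
  rw [hre]
  linarith

/-- **Across the cut plane, above | below: the same bound with the table entry of the (below, above) slab pair.** -/
theorem lawW_le_cell_of_above_below (k : Fin rc.nk) {i i' : Fin I.cells.M} (hi : polytope (I.cells.Hp i) ⊆ polytope (μ.HP k))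
    (hi' : polytope (I.cells.Hp i') ⊆ polytope (μ.HP k)) (ha : I.cutDatum k ∉ I.cells.T (I.cells.idx i))
    (hb : I.cutDatum k ∈ I.cells.T (I.cells.idx i')) {ν : E3} (hν : ν = (rc.cell k).M e₃ ∨ ν = -((rc.cell k).M e₃)) :
    lawW I.frameOf (I.cells.cls i) (I.cells.cls i') ν ≤ (rc.cell k).c (I.slab i') (I.slab i) / 2 := by
  have hgi : I.grain i = μ.gk k := by rw [I.grain_eq_of_piece_subset_HP hi, if_neg ha]
  have hgi' : I.grain i' = μ.fk k := by rw [I.grain_eq_of_piece_subset_HP hi', if_pos hb]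
  have h₁ : (((rc.cell k).A₂ (I.slab i)).trans (rc.cell k).M) '' fccRef = I.frameOf (I.cells.cls i) '' fccRef := by
    rw [I.frameOf_cls i, hgi]; exact μ.cell_lattice₂ k (I.slab i)
  have h₂ : (((rc.cell k).A₁ (I.slab i')).trans (rc.cell k).M) '' fccRef = I.frameOf (I.cells.cls i') '' fccRef := by
    rw [I.frameOf_cls i', hgi']; exact μ.cell_lattice₁ k (I.slab i')
  have hadm := (rc.cell k).hadm
  have hlaw := μ.hlaw k (I.slab i') (I.slab i)
  have h := lawC_mul_supportFn_le_cell I.frameOf (ℓ := I.cells.cls i) (ℓ' := I.cells.cls i')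
    (A₁ := (rc.cell k).A₂ (I.slab i)) (A₂ := (rc.cell k).A₁ (I.slab i')) (c := (rc.cell k).c (I.slab i') (I.slab i))
    (mk := (rc.cell k).m (I.slab i') (I.slab i)) h₁ h₂ (hadm.1 _ _)
    (fun hnco => hlaw.1 (fun hco => hnco (coAx_comm hco)))
    (fun hco hne => hlaw.2 (coAx_comm hco) (Ne.symm hne))
    (fun hco hne => sharedAxis_comm (hadm.2.2.1 _ _ (coAx_comm hco) (Ne.symm hne)).1) hν
  unfold lawW
  have hre : lawC I.frameOf (I.cells.cls i) (I.cells.cls i') / 2 * supportFn (wallBody (lawM I.frameOf (I.cells.cls i) (I.cells.cls i'))) ν =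
      lawC I.frameOf (I.cells.cls i) (I.cells.cls i') * supportFn (wallBody (lawM I.frameOf (I.cells.cls i) (I.cells.cls i'))) ν / 2 := by
    ring
  rw [hre]
  linarith

/-! ### One ledger term across the cut -/

/-- The contact set is symmetric in the two pieces (up to the orientation of the datum). -/
theorem contact_antip_comm (i i' : Fin I.cells.M) (p : E3 × ℝ) : I.contact i i' (antip p) = I.contact i' i p := by
  ext y
  simp only [contact, antip, mem_inter_iff, mem_setOf_eq, inner_neg_left, neg_inj]
  tauto

/-- **One term, below side**: against a piece above the cut `≤ c/2 · area`, against a piece on the same side `0`. -/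
theorem cut_term_le (k : Fin rc.nk) {i i' : Fin I.cells.M} (hne : i ≠ i') (hi : polytope (I.cells.Hp i) ⊆ polytope (μ.HP k))
    (hi' : polytope (I.cells.Hp i') ⊆ polytope (μ.HP k)) (hcd : I.cutDatum k ∈ I.cells.Hp i) :
    lawW I.frameOf (I.cells.cls i) (I.cells.cls i') (I.cutDatum k).1 * facetArea (I.contact i i' (I.cutDatum k)) (I.cutDatum k).1 ≤
      if antip (I.cutDatum k) ∈ I.cells.Hp i' then
        (rc.cell k).c (I.slab i) (I.slab i') / 2 * facetArea (I.contact i i' (I.cutDatum k)) (I.cutDatum k).1 else 0 := by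
  split_ifs with ha
  · exact mul_le_mul_of_nonneg_right
      (I.lawW_le_cell_of_below_above k hi hi' (I.cutDatum_mem_T_of_mem_Hp hcd) (I.cutDatum_not_mem_T_of_antip_mem_Hp ha) (Or.inl rfl))
      (facetArea_nonneg _ _)
  · -- both below: the contact along the cut plane is null
    have hcd' : I.cutDatum k ∈ I.cells.Hp i' := (I.cutDatum_mem_Hp_or i' k).resolve_right ha
    have h0 : facetArea (I.contact i i' (I.cutDatum k)) (I.cutDatum k).1 = 0 := by
      have h := facetArea_inter_eq_zero_of_sameSide (I.norm_cutDatum k) (I.below_of_cutDatum_mem hcd) (I.below_of_cutDatum_mem hcd')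
        (I.cells.hdisj_Hp i i' hne)
      have hset : I.contact i i' (I.cutDatum k) =
          closure (polytope (I.cells.Hp i)) ∩ closure (polytope (I.cells.Hp i')) ∩ {x : E3 | ⟪(I.cutDatum k).1, x⟫_ℝ = (I.cutDatum k).2} := by
        ext y; simp only [contact, mem_inter_iff, mem_setOf_eq]; tauto
      rw [hset]; exact h
    rw [h0, mul_zero]

/-- **One term, above side**: against a piece below the cut `≤ c/2 · area` (in the (below, above) indexing), against the same side `0`. -/
theorem cut_term_le' (k : Fin rc.nk) {i i' : Fin I.cells.M} (hne : i ≠ i') (hi : polytope (I.cells.Hp i) ⊆ polytope (μ.HP k))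
    (hi' : polytope (I.cells.Hp i') ⊆ polytope (μ.HP k)) (hacd : antip (I.cutDatum k) ∈ I.cells.Hp i) :
    lawW I.frameOf (I.cells.cls i) (I.cells.cls i') (antip (I.cutDatum k)).1 *
        facetArea (I.contact i i' (antip (I.cutDatum k))) (antip (I.cutDatum k)).1 ≤
      if I.cutDatum k ∈ I.cells.Hp i' then
        (rc.cell k).c (I.slab i') (I.slab i) / 2 * facetArea (I.contact i' i (I.cutDatum k)) (I.cutDatum k).1 else 0 := by
  have hA : facetArea (I.contact i i' (antip (I.cutDatum k))) (antip (I.cutDatum k)).1 = facetArea (I.contact i' i (I.cutDatum k)) (I.cutDatum k).1 := by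
    rw [I.contact_antip_comm]
    exact facetArea_neg _ _
  rw [hA]
  split_ifs with hb
  · exact mul_le_mul_of_nonneg_right
      (I.lawW_le_cell_of_above_below k hi hi' (I.cutDatum_not_mem_T_of_antip_mem_Hp hacd) (I.cutDatum_mem_T_of_mem_Hp hb) (Or.inr rfl))
      (facetArea_nonneg _ _)
  · have hacd' : antip (I.cutDatum k) ∈ I.cells.Hp i' := (I.cutDatum_mem_Hp_or i' k).resolve_left hb
    have h0 : facetArea (I.contact i' i (I.cutDatum k)) (I.cutDatum k).1 = 0 := by
      rw [← facetArea_neg]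
      have h := facetArea_inter_eq_zero_of_sameSide (n := -(I.cutDatum k).1) (by rw [norm_neg]; exact I.norm_cutDatum k)
        (I.above_of_antip_cutDatum_mem hacd') (I.above_of_antip_cutDatum_mem hacd) (I.cells.hdisj_Hp i' i hne.symm)
      have hset : I.contact i' i (I.cutDatum k) =
          closure (polytope (I.cells.Hp i')) ∩ closure (polytope (I.cells.Hp i)) ∩ {x : E3 | ⟪-(I.cutDatum k).1, x⟫_ℝ = -(I.cutDatum k).2} := by
        ext y; simp only [contact, mem_inter_iff, mem_setOf_eq, inner_neg_left, neg_inj]; tauto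
      rw [hset]; exact h
    rw [h0, mul_zero]

/-! ### The cut-plane area bound -/

open scoped Classical in
/-- **Σ over (below in slab `a`) × (above in slab `b`) of the contact areas on the cut plane is at most the area of the cut region
`cl P_k ∩ cl slab^{fk}_a ∩ cl slab^{gk}_b ∩ cut plane`.** -/
theorem sum_sum_facetArea_cut_le (k : Fin rc.nk) (a b : ℤ) :
    ∑ i ∈ Finset.univ.filter (fun i => polytope (I.cells.Hp i) ⊆ polytope (μ.HP k) ∧ I.cutDatum k ∈ I.cells.Hp i ∧ I.slab i = a),
      ∑ i' ∈ Finset.univ.filter (fun i' => polytope (I.cells.Hp i') ⊆ polytope (μ.HP k) ∧ antip (I.cutDatum k) ∈ I.cells.Hp i' ∧ I.slab i' = b),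
        facetArea (I.contact i i' (I.cutDatum k)) (I.cutDatum k).1 ≤
    facetArea (closure (polytope (μ.HP k)) ∩ closure (laySlab (rc.tent (μ.fk k)).L (rc.tent (μ.fk k)).s a) ∩
      closure (laySlab (rc.tent (μ.gk k)).L (rc.tent (μ.gk k)).s b) ∩ {y : E3 | ⟪(I.cutDatum k).1, y⟫_ℝ = (I.cutDatum k).2}) (I.cutDatum k).1 := by
  set n : E3 := (I.cutDatum k).1 with hn_def
  set lvl : ℝ := (I.cutDatum k).2 with hlvl_def
  have hn : ‖n‖ = 1 := I.norm_cutDatum k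
  have hn' : ‖-n‖ = 1 := by rw [norm_neg]; exact hn
  set Below := Finset.univ.filter (fun i => polytope (I.cells.Hp i) ⊆ polytope (μ.HP k) ∧ I.cutDatum k ∈ I.cells.Hp i ∧ I.slab i = a) with hBelow
  set Above := Finset.univ.filter (fun i' => polytope (I.cells.Hp i') ⊆ polytope (μ.HP k) ∧ antip (I.cutDatum k) ∈ I.cells.Hp i' ∧ I.slab i' = b)
    with hAbove
  set Sa : Set E3 := laySlab (rc.tent (μ.fk k)).L (rc.tent (μ.fk k)).s a with hSa
  set Sb : Set E3 := laySlab (rc.tent (μ.gk k)).L (rc.tent (μ.gk k)).s b with hSb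
  set Pl : Set E3 := {y : E3 | ⟪n, y⟫_ℝ = lvl} with hPl
  set R : Set E3 := closure (polytope (μ.HP k)) ∩ closure Sa ∩ closure Sb ∩ Pl with hR
  have hPl' : Pl = {y : E3 | ⟪-n, y⟫_ℝ = -lvl} := by
    ext y; simp only [hPl, mem_setOf_eq, inner_neg_left, neg_inj]
  have hPlc : IsClosed Pl := isClosed_eq (continuous_const.inner continuous_id) continuous_const
  have hPbd := μ.hPbd k
  -- what membership in `Below` / `Above` gives
  have hBel : ∀ i ∈ Below, polytope (I.cells.Hp i) ⊆ polytope (μ.HP k) ∧ polytope (I.cells.Hp i) ⊆ {x : E3 | ⟪n, x⟫_ℝ < lvl} ∧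
      polytope (I.cells.Hp i) ⊆ Sa := by
    intro i hi
    obtain ⟨hP, hcd, hsl⟩ := (Finset.mem_filter.1 hi).2
    refine ⟨hP, I.below_of_cutDatum_mem hcd, ?_⟩
    have hg : I.grain i = μ.fk k := by rw [I.grain_eq_of_piece_subset_HP hP, if_pos (I.cutDatum_mem_T_of_mem_Hp hcd)]
    have h := I.subset_laySlab i
    rw [hg, hsl] at h
    exact h
  have hAbo : ∀ i' ∈ Above, polytope (I.cells.Hp i') ⊆ polytope (μ.HP k) ∧ polytope (I.cells.Hp i') ⊆ {x : E3 | ⟪-n, x⟫_ℝ < -lvl} ∧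
      polytope (I.cells.Hp i') ⊆ Sb := by
    intro i' hi'
    obtain ⟨hP, hacd, hsl⟩ := (Finset.mem_filter.1 hi').2
    refine ⟨hP, I.above_of_antip_cutDatum_mem hacd, ?_⟩
    have hg : I.grain i' = μ.gk k := by rw [I.grain_eq_of_piece_subset_HP hP, if_neg (I.cutDatum_not_mem_T_of_antip_mem_Hp hacd)]
    have h := I.subset_laySlab i'
    rw [hg, hsl] at h
    exact h
  -- inner sum, for a fixed `i` below: ≤ area of `R_i := cl i ∩ Pl ∩ cl Sb`
  have hinner : ∀ i ∈ Below, ∑ i' ∈ Above, facetArea (I.contact i i' (I.cutDatum k)) n ≤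
      facetArea (closure (polytope (I.cells.Hp i)) ∩ Pl ∩ closure Sb) n := by
    intro i hi
    set Ri : Set E3 := closure (polytope (I.cells.Hp i)) ∩ Pl ∩ closure Sb with hRi
    have hRic : IsClosed Ri := (isClosed_closure.inter hPlc).inter isClosed_closure
    have hRib : Bornology.IsBounded Ri := ((I.cells.hbd_Hp i).closure.subset inter_subset_left).subset inter_subset_left
    have hRiPl : Ri ⊆ {y : E3 | ⟪-n, y⟫_ℝ = -lvl} := fun y hy => by rw [← hPl']; exact hy.1.2
    calc ∑ i' ∈ Above, facetArea (I.contact i i' (I.cutDatum k)) n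
        ≤ ∑ i' ∈ Above, facetArea (closure (polytope (I.cells.Hp i')) ∩ Ri) n := by
          refine Finset.sum_le_sum fun i' hi' => ?_
          refine facetArea_mono_of_subset hPbd (fun y hy => closure_mono (hAbo i' hi').1 hy.1) (fun y hy => ?_) n
          exact ⟨hy.2, ⟨hy.1.1, hy.1.2⟩, closure_mono (hAbo i' hi').2.2 hy.2⟩
      _ = ∑ i' ∈ Above, facetArea (closure (polytope (I.cells.Hp i')) ∩ Ri) (-n) := by
          refine Finset.sum_congr rfl fun i' _ => (facetArea_neg _ _).symm
      _ ≤ facetArea Ri (-n) :=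
          sum_facetArea_inter_le_of_sameSide Above I.cells.Hp hn' (fun i' hi' => (hAbo i' hi').2.1)
            (fun i' _ j' _ hij => I.cells.hdisj_Hp i' j' hij) hRiPl hRic hRib
      _ = facetArea Ri n := facetArea_neg _ _
  -- outer sum
  have hRc : IsClosed R := ((isClosed_closure.inter isClosed_closure).inter isClosed_closure).inter hPlc
  have hRb : Bornology.IsBounded R := ((hPbd.closure.subset inter_subset_left).subset inter_subset_left).subset inter_subset_left
  have hRPl : R ⊆ {y : E3 | ⟪n, y⟫_ℝ = lvl} := fun y hy => hy.2
  calc ∑ i ∈ Below, ∑ i' ∈ Above, facetArea (I.contact i i' (I.cutDatum k)) n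
      ≤ ∑ i ∈ Below, facetArea (closure (polytope (I.cells.Hp i)) ∩ Pl ∩ closure Sb) n := Finset.sum_le_sum hinner
    _ ≤ ∑ i ∈ Below, facetArea (closure (polytope (I.cells.Hp i)) ∩ R) n := by
        refine Finset.sum_le_sum fun i hi => ?_
        refine facetArea_mono_of_subset hPbd (fun y hy => closure_mono (hBel i hi).1 hy.1) (fun y hy => ?_) n
        exact ⟨hy.1.1, ⟨⟨closure_mono (hBel i hi).1 hy.1.1, closure_mono (hBel i hi).2.2 hy.1.1⟩, hy.2⟩, hy.1.2⟩
    _ ≤ facetArea R n :=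
        sum_facetArea_inter_le_of_sameSide Below I.cells.Hp hn (fun i hi => (hBel i hi).2.1)
          (fun i _ j _ hij => I.cells.hdisj_Hp i j hij) hRPl hRc hRb

end TexInput

end Summit.Ventures.Crystal3D.Cruxes.TextureLiminf.TexShadow

end
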